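import Literature.MeasureTheory.Group.InvariantQuotientUnfolding
import Literature.MeasureTheory.Group.InvariantQuotientExistence
import Mathlib.MeasureTheory.Group.ModularCharacter
import HarnessLib

/-!
# A group with a cocompact closed unimodular subgroup of finite covolume is unimodular
(Raghunathan, *Discrete subgroups of Lie groups* (1972), Ch. I, Remark 1.9; Weil,
*L'intégration dans les groupes topologiques* (1940), §9; Folland (1995), (2.49)–(2.52))

Topic `MeasureTheory/Group`; theorems only. Companion to `LatticeUnimodular` (the case of a
discrete cocompact subgroup with a fundamental domain) and to
`AdelicGroupDataQuotientUnimodular` (unimodularity of `H = A_G · G(K)`). Let `G` be a locally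
compact second countable Hausdorff group, `H ≤ G` closed, `ρ` a Haar measure on `H` that is also
*right* invariant (`H` unimodular), `μ ≠ 0` a `G`-invariant Borel measure on `G ⧸ H` finite on
compact sets, and `ν` a (left) Haar measure on `G`.

* `map_mul_right_eq_self_of_mem` — **`ν` is right invariant under `H`**: by Weil's formula
  (`InvariantQuotientUnfolding.lintegral_fiberLIntegral_eq_mul_lintegral`)
  `c ∫_G f(g h₀) dν = ∫_{G ⧸ H} ∫_H f(g h h₀) dρ dμ = ∫_{G ⧸ H} ∫_H f(g h) dρ dμ = c ∫_G f dν`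
  (right invariance of `ρ`), so `Δ_G = 1` on `H`;
* `map_mul_right_eq_modularCharacter_smul` — `(· g)_* ν = Δ(g) • ν` with Mathlib's modular
  character (second countable form of `map_right_mul_eq_modularCharacterFun_smul`, no regularity
  hypothesis);
* `modularCharacter_eq_one_of_compactSpace_quotient` — **if moreover `G ⧸ H` is compact then
  `Δ_G ≡ 1`**: `G = C · H` for a compact `C`, so `Δ_G(G) = Δ_G(C)`; and `Δ_G` is bounded below on
  `C` (`Δ(c) ν(U C) = ν(U C c⁻¹) ≥ ν(U)` for an open relatively compact `U ∋ 1`), hence on `G`;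
  a multiplicative map `G → ℝ_{>0}` bounded below is trivial;
* `isMulRightInvariant_of_compactSpace_quotient` — **`G` is unimodular** (`ν` right invariant).

Application: `G = D_𝔸ˣ` for a division quaternion algebra, `H = ℝ_{>0} · Dˣ` (unimodular,
`AdelicGroupDataQuotientUnimodular`; compact quotient, Fujisaki; automorphic measure), giving the
two-sided Haar measure needed for the invariant measures on `G ⧸ G_γ` (`InvariantQuotientAbelian`)
in the trace formula for `D^×` (Gelbart (1975), Remark 9.23); part of the inline (D-0026)
decomposition of `Literature.NumberTheory.Automorphic.strong_multiplicity_one_quaternionUnits`.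

## References

* M. S. Raghunathan, *Discrete subgroups of Lie groups* (1972), Ch. I, Remark 1.9 [folklore].
* G. B. Folland, *A Course in Abstract Harmonic Analysis* (1995), §2.4 (modular function), §2.6
  Thm. 2.49 [Folland1995].
* S. Gelbart, *Automorphic forms on adele groups* (1975), Remark 9.23 [Gelbart1975].
-/

noncomputable section

open _root_.MeasureTheory _root_.MeasureTheory.Measure _root_.Topology Set Filter
open scoped ENNReal NNReal Pointwise

/- Work with Borel structures on the coset spaces, as in `InvariantQuotientUnfolding`. -/
attribute [-instance] Quotient.instMeasurableSpace QuotientGroup.measurableSpace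

namespace Literature.MeasureTheory.Group

section Unimodular

variable {G : Type*} [Group G] [TopologicalSpace G] [IsTopologicalGroup G] [LocallyCompactSpace G]
  [SecondCountableTopology G] [T2Space G] [MeasurableSpace G] [BorelSpace G]
  (H : Subgroup G) [hH : IsClosed (H : Set G)]
  (ρ : Measure H) [ρ.IsMulLeftInvariant] [ρ.IsMulRightInvariant] [SFinite ρ]
  [IsFiniteMeasureOnCompacts ρ]
  [MeasurableSpace (G ⧸ H)] [BorelSpace (G ⧸ H)]
  (μ : Measure (G ⧸ H)) [SMulInvariantMeasure G (G ⧸ H) μ] [IsFiniteMeasureOnCompacts μ]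
  (ν : Measure G) [IsHaarMeasure ν]

include hH μ in
/-- **A Haar measure of `G` is right invariant under a closed unimodular subgroup `H` of finite
covolume** (`G ⧸ H` carrying a non-zero invariant measure finite on compact sets). Weil's
formula `∫_{G ⧸ H} ∫_H f(g h) dρ dμ = c ∫_G f dν` (`c > 0`) applied to `f` and to `f(· h₀)`,
whose fibre integrals agree by the right invariance of `ρ`, gives `∫_G f(g h₀) dν = ∫_G f dν`
(Folland (1995), (2.49)–(2.52); `Δ_G|_H = Δ_H`). [cite: Folland1995, §2.6 Thm. 2.49] -/
theorem map_mul_right_eq_self_of_mem (hμ : μ ≠ 0) (hρ : ρ ≠ 0) {h₀ : G} (hh₀ : h₀ ∈ H) :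
    Measure.map (· * h₀) ν = ν := by
  have hc : (unfoldingConstant H ρ μ ν : ℝ≥0∞) ≠ 0 :=
    ENNReal.coe_ne_zero.2 (unfoldingConstant_pos H ρ μ ν hμ hρ).ne'
  -- `∫ f(g h₀) dν = ∫ f dν` for Borel `f ≥ 0`
  have key : ∀ f : G → ℝ≥0∞, Measurable f → ∫⁻ g, f (g * h₀) ∂ν = ∫⁻ g, f g ∂ν := by
    intro f hf
    have hf' : Measurable fun g => f (g * h₀) := hf.comp (measurable_mul_const h₀)
    have h1 := lintegral_fiberLIntegral_eq_mul_lintegral H ρ μ ν hf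
    have h2 := lintegral_fiberLIntegral_eq_mul_lintegral H ρ μ ν hf'
    have hfib : fiberLIntegral H ρ (fun g => f (g * h₀)) = fiberLIntegral H ρ f := by
      funext x
      induction x using QuotientGroup.induction_on with
      | H g =>
        rw [fiberLIntegral_mk, fiberLIntegral_mk]
        have h3 := lintegral_mul_right_eq_self (μ := ρ) (fun h : H => f (g * h)) ⟨h₀, hh₀⟩
        refine Eq.trans (lintegral_congr fun h => ?_) h3
        simp only [Subgroup.coe_mul, mul_assoc]
    rw [hfib, h1] at h2
    exact ((ENNReal.mul_right_inj hc ENNReal.coe_ne_top).1 h2).symm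
  ext E hE
  rw [Measure.map_apply (measurable_mul_const h₀) hE, ← lintegral_indicator_one hE,
    ← lintegral_indicator_one (measurable_mul_const h₀ hE)]
  have h4 : (fun g => ((· * h₀) ⁻¹' E).indicator (1 : G → ℝ≥0∞) g) =
      fun g => E.indicator 1 (g * h₀) := by
    funext g
    by_cases hg : g * h₀ ∈ E
    · rw [indicator_of_mem hg, indicator_of_mem (show g ∈ (· * h₀) ⁻¹' E from hg)]
      rfl
    · rw [indicator_of_notMem hg, indicator_of_notMem (show g ∉ (· * h₀) ⁻¹' E from hg)]
  rw [h4]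
  exact key _ (measurable_one.indicator hE)

omit hH [MeasurableSpace (G ⧸ H)] [BorelSpace (G ⧸ H)] [T2Space G] in
/-- `(· g)_* ν = Δ(g) • ν` with Mathlib's modular character `Δ = modularCharacter`, in a second
countable locally compact group (no regularity hypothesis: `isMulLeftInvariant_eq_smul`).
[folklore] -/
theorem map_mul_right_eq_modularCharacter_smul (g : G) :
    Measure.map (· * g) ν = modularCharacter g • ν := by
  have h := isMulLeftInvariant_eq_smul (Measure.map (· * g) ν) ν
  rwa [← modularCharacterFun_eq_haarScalarFactor ν g] at h

omit hH [MeasurableSpace (G ⧸ H)] [BorelSpace (G ⧸ H)] [SecondCountableTopology G] [T2Space G]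
  [MeasurableSpace G] [BorelSpace G] [TopologicalSpace G] [IsTopologicalGroup G]
  [LocallyCompactSpace G] in
/-- A multiplicative map `χ : G → ℝ≥0` bounded below by a positive constant is trivial
(`χ(gⁿ) = χ(g)ⁿ` and `χ(g⁻ⁿ) = χ(g)⁻ⁿ`). [folklore] -/
theorem monoidHom_eq_one_of_bddBelow (χ : G →* ℝ≥0) {ε : ℝ≥0} (hε : 0 < ε)
    (hlow : ∀ g, ε ≤ χ g) (g : G) : χ g = 1 := by
  have hpos : ∀ g, 0 < χ g := fun g => hε.trans_le (hlow g)
  -- both `χ g` and `χ g⁻¹ = (χ g)⁻¹` have all powers `≥ ε`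
  have hpow : ∀ (x : G) (n : ℕ), ε ≤ (χ x) ^ n := fun x n => by
    rw [← map_pow]; exact hlow _
  have hinv : χ g⁻¹ = (χ g)⁻¹ :=
    eq_inv_of_mul_eq_one_left (by rw [← map_mul, inv_mul_cancel, map_one])
  by_contra hne
  rcases lt_or_gt_of_ne hne with hlt | hgt
  · -- `χ g < 1`: powers tend to `0`
    obtain ⟨n, hn⟩ := exists_pow_lt_of_lt_one hε hlt
    exact (lt_irrefl _) ((hpow g n).trans_lt hn)
  · -- `χ g > 1`: `χ g⁻¹ < 1`
    have hlt : χ g⁻¹ < 1 := by rw [hinv]; exact inv_lt_one_of_one_lt₀ hgt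
    obtain ⟨n, hn⟩ := exists_pow_lt_of_lt_one hε hlt
    exact (lt_irrefl _) ((hpow g⁻¹ n).trans_lt hn)

omit hH [MeasurableSpace (G ⧸ H)] [BorelSpace (G ⧸ H)] in
/-- **The modular function of `G` is trivial when `G ⧸ H` is compact and `Δ_G = 1` on `H`**:
`G = C · H` for a compact `C` (`exists_isCompact_image_mk_superset`), so `Δ_G(G) = Δ_G(C)`; and
`Δ_G` is bounded below on `C`, for `Δ(c) ν(U C) = ν((U C) c⁻¹) ≥ ν(U)` with `U ∋ 1` open
relatively compact; a multiplicative map bounded below is trivial. [folklore] -/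
theorem modularCharacter_eq_one_of_compactSpace_quotient [CompactSpace (G ⧸ H)]
    (hH1 : ∀ h ∈ H, Measure.map (· * h) ν = ν) (g : G) : modularCharacter g = 1 := by
  -- `Δ = 1` on `H`
  have hΔH : ∀ h ∈ H, modularCharacter h = 1 := by
    intro h hh
    have h1 := map_mul_right_eq_modularCharacter_smul ν h
    rw [hH1 h hh] at h1
    -- `ν = Δ h • ν` with `0 < ν K < ∞` for a compact neighbourhood `K`
    obtain ⟨K, hK, hK1⟩ := exists_compact_mem_nhds (1 : G)
    have hKpos : 0 < ν K := measure_pos_of_mem_nhds ν hK1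
    have hKtop : ν K ≠ ∞ := hK.measure_lt_top.ne
    have h2 : ν K = modularCharacter h * ν K := by
      conv_lhs => rw [h1]
      rfl
    have h3 : (modularCharacter h : ℝ≥0∞) = 1 := by
      have := (ENNReal.mul_left_inj hKpos.ne' hKtop).1 (h2.symm.trans (one_mul _).symm)
      exact this
    exact_mod_cast h3
  -- `G = C · H` with `C` compact
  obtain ⟨C, hC, hCuniv⟩ := exists_isCompact_image_mk_superset H (isCompact_univ (X := G ⧸ H))
  have hdec : ∀ x : G, ∃ c ∈ C, ∃ h ∈ H, x = c * h := by
    intro x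
    obtain ⟨c, hc, hcx⟩ := hCuniv (Set.mem_univ (QuotientGroup.mk x : G ⧸ H))
    refine ⟨c, hc, c⁻¹ * x, QuotientGroup.eq.1 hcx, by rw [mul_inv_cancel_left]⟩
  -- lower bound on `C`: `Δ(c) ν(U C) ≥ ν(U)`
  obtain ⟨U, hU1, hUo, hUc⟩ : ∃ U : Set G, (1 : G) ∈ U ∧ IsOpen U ∧ IsCompact (closure U) := by
    obtain ⟨K, hK, hK1⟩ := exists_compact_mem_nhds (1 : G)
    exact ⟨interior K, mem_interior_iff_mem_nhds.2 hK1, isOpen_interior,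
      hK.of_isClosed_subset isClosed_closure (closure_minimal interior_subset hK.isClosed)⟩
  have hUpos : 0 < ν U := hUo.measure_pos ν ⟨1, hU1⟩
  have hUtop : ν U ≠ ∞ := (measure_mono subset_closure).trans_lt hUc.measure_lt_top |>.ne
  set S : Set G := closure U * C with hS
  have hSc : IsCompact S := hUc.mul hC
  have hStop : ν S ≠ ∞ := hSc.measure_lt_top.ne
  have hSm : MeasurableSet S := hSc.isClosed.measurableSet
  -- `C` is non-empty, so `S ⊇ U c₀` has positive measure
  obtain ⟨c₀, hc₀, -⟩ := hdec 1
  have hSpos : ν S ≠ 0 := by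
    have hsub : (fun u => u * c₀) '' U ⊆ S := by
      rintro _ ⟨u, hu, rfl⟩
      exact Set.mul_mem_mul (subset_closure hu) hc₀
    have hopen : IsOpen ((fun u => u * c₀) '' U) := (Homeomorph.mulRight c₀).isOpenMap U hUo
    exact ((hopen.measure_pos ν ⟨1 * c₀, 1, hU1, rfl⟩).trans_le (measure_mono hsub)).ne'
  -- the lower bound `ε = ν(U) / ν(S)`
  have hεtop : ν U / ν S ≠ ∞ := ENNReal.div_ne_top hUtop hSpos
  have hεpos : 0 < ν U / ν S := ENNReal.div_pos hUpos.ne' hStop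
  set ε : ℝ≥0 := (ν U / ν S).toNNReal with hε
  have hεcoe : (ε : ℝ≥0∞) = ν U / ν S := ENNReal.coe_toNNReal hεtop
  have hε0 : 0 < ε := by
    rw [← ENNReal.coe_pos, hεcoe]; exact hεpos
  -- `Δ(c) ≥ ε` on `C`
  have hlowC : ∀ c ∈ C, ε ≤ modularCharacter c := by
    intro c hc
    have h1 := map_mul_right_eq_modularCharacter_smul ν c
    have h2 : ν U ≤ Measure.map (· * c) ν S := by
      rw [Measure.map_apply (measurable_mul_const c) hSm]
      exact measure_mono fun u hu => Set.mul_mem_mul (subset_closure hu) hc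
    rw [h1, Measure.coe_nnreal_smul_apply] at h2
    have h3 : ν U / ν S ≤ modularCharacter c := ENNReal.div_le_of_le_mul h2
    rw [← hεcoe] at h3
    exact_mod_cast h3
  -- hence on `G`, and `Δ ≡ 1`
  refine monoidHom_eq_one_of_bddBelow modularCharacter hε0 (fun x => ?_) g
  obtain ⟨c, hc, h, hh, rfl⟩ := hdec x
  rw [map_mul, hΔH h hh, mul_one]
  exact hlowC c hc

include hH μ in
/-- **A locally compact group with a closed, unimodular, cocompact subgroup of finite covolume is
unimodular** (Raghunathan (1972), Ch. I, Remark 1.9, for lattices; here for a closed subgroup `H`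
with a two-sided Haar measure `ρ`, a non-zero invariant measure `μ` on the compact quotient
`G ⧸ H`): every left Haar measure `ν` of `G` is right invariant
(`map_mul_right_eq_self_of_mem` and `modularCharacter_eq_one_of_compactSpace_quotient`).
[folklore] -/
theorem isMulRightInvariant_of_compactSpace_quotient [CompactSpace (G ⧸ H)] (hμ : μ ≠ 0)
    (hρ : ρ ≠ 0) : ν.IsMulRightInvariant := by
  refine ⟨fun g => ?_⟩
  rw [map_mul_right_eq_modularCharacter_smul ν g,
    modularCharacter_eq_one_of_compactSpace_quotient H ν
      (fun h hh => map_mul_right_eq_self_of_mem H ρ μ ν hμ hρ hh) g, one_smul]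

end Unimodular

end Literature.MeasureTheory.Group
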